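import Summits.Ventures.Crystal3D.Theorems.StickyWulffConstantCoaxialWallLawPayerTransCellGenericMulti
import Summits.Ventures.Crystal3D.Theorems.StickyWulffConstantCoaxialWallLawPayerAssembly
import Summits.Ventures.Crystal3D.Theorems.StickyWulffConstantCoaxialWallLawSkewAxis
import Summits.Ventures.Crystal3D.Theorems.StickyWulffConstantGenericWallFloorMixedDozenRules
import HarnessLib

/-!
# End accounting, census-free, multi-source IV: the generic translation rung sourced from ALL rising slots —
# charge `φ₁/78` (the bottom grain's full horizontal flux), KissingGap + KissingClassification only

HONEST FRAMING. Part of the venture `Summits/Ventures/Crystal3D` (cell `crystal3d-full`), helper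
`--supports` the crux `CoaxialWallLaw` (stmt-Ventures-19481, `route-Ventures-StickyWulffConstant`),
REGISTERED line `WallLedgerF` (planner cf-p1), open stub `stub_coaxialTwoSlabAdhesion`.
RUNG CREDIT ONLY.  Brick (B4b) of memo HOME/wall-19481-p2/F-MULTISOURCE.md (19481-p2 g4): the first MULTI-ROOT rung in
the kernel.  `translate_twoSlabAdhesion_generic_censusFree` (`…PayerTrans`) sources the word automaton at the steepest slot
only (flux `√2·α ≥ 1`, charge `1/156`); here every RISING slot of the bottom frame is a root
(`wordNet_trans_payers_ge_generic_multi`, `…PayerTransCellGenericMulti`), the end pairs of different roots being disjoint by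
LEMMA X and sharing one capacity `78·#PAY`.  By central symmetry of the slot dozen the total flux is the bottom grain's
full horizontal bond flux: `√2·Σ_{(A₁ r)₂ > 0} (A₁ r)₂ = (√2/2)·Σ_w |(A₁ w)₂| = 2φ₁`
(`sqrt_two_mul_sum_rising_eq_two_phi`).

* `translate_twoSlabAdhesion_generic_multi` — ANY translation pair `A₁·Λ₀ = A₂·Λ₀` with a 3-adically generic offset:
  `cross(P₁, X∖P₁) + cross(P₂, Y) ≤ D(Y) + (φ₁ + φ₂ − φ₁/78)·π ρ² + C(1+h)ρ`, i.e. charge `φ₁/78 ≥ √3/78 ≈ 0.0222`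
  ORIENTATION-FREE (vs `1/156 ≈ 0.0064`), modulo `KissingGap δ`, `KissingClassification δ` only.

WHAT THIS IS NOT: not the stub (`½·sin θ`); one-sided (bottom plate only — the mirror families of the top plate double it
to `(φ₁+φ₂)/78`, next brick); the skew cases (B)/(C) of the trichotomy keep their single-root constants for now; F-C1 not
moved.
-/

noncomputable section

namespace Summit.Ventures.Crystal3D.Theorems

open Summit.Ventures.Crystal3D Finset
open Literature.MathematicalPhysics.StatisticalMechanics (fccStacking barlowStacking IsHaggSeq
  contactDeficiency)
open scoped InnerProductSpace

/-- The slot dozen is centrally symmetric (as a finite set). -/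
theorem image_neg_fccSlots : fccSlots.image (fun w : EuclideanSpace ℝ (Fin 3) => -w) = fccSlots := by
  ext w
  rw [mem_image]
  constructor
  · rintro ⟨w', hw', rfl⟩; exact neg_mem_fccSlots hw'
  · intro hw; exact ⟨-w, neg_mem_fccSlots hw, neg_neg w⟩

open scoped Classical in
/-- **The rising-slot flux is the full horizontal flux**: `√2 · Σ_{(A r)₂ > 0} (A r)₂ = 2·φ(A)`, where
`φ(A) = (√2/4)·∑ᶠ_{‖w‖ = 1, w ∈ Λ₀} |⟪w, A⁻¹ e₃⟫|`. -/
theorem sqrt_two_mul_sum_rising_eq_two_phi (A : EuclideanSpace ℝ (Fin 3) ≃ₗᵢ[ℝ] EuclideanSpace ℝ (Fin 3)) :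
    Real.sqrt 2 * ∑ r ∈ fccSlots.filter (fun r => 0 < (A r) 2), (A r) 2 =
      2 * (Real.sqrt 2 / 4 * ∑ᶠ w ∈ {w ∈ fccStacking 1 (Real.sqrt (2 / 3)) | ‖w‖ = 1},
        |⟪w, A.symm (EuclideanSpace.single (2 : Fin 3) (1 : ℝ))⟫_ℝ|) := by
  set e₃ : EuclideanSpace ℝ (Fin 3) := EuclideanSpace.single (2 : Fin 3) (1 : ℝ) with he₃
  have hx : ∀ w : EuclideanSpace ℝ (Fin 3), ⟪w, A.symm e₃⟫_ℝ = (A w) 2 := by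
    intro w
    rw [← LinearIsometryEquiv.inner_map_map A w (A.symm e₃), LinearIsometryEquiv.apply_symm_apply,
      apply_two_eq_inner_e₃]
  rw [finsum_unit_fcc_eq_sum]
  simp_rw [hx]
  -- `|x| = x⁺ + (−x)⁺` and the negation involution of the slots
  have hsplit : ∀ w : EuclideanSpace ℝ (Fin 3),
      |(A w) 2| = (if 0 < (A w) 2 then (A w) 2 else 0) + (if 0 < (A (-w)) 2 then (A (-w)) 2 else 0) := by
    intro w
    rw [map_neg, PiLp.neg_apply]
    by_cases h : 0 < (A w) 2
    · rw [if_pos h, if_neg (by linarith), abs_of_pos h, add_zero]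
    · rcases lt_or_eq_of_le (not_lt.1 h) with h' | h'
      · rw [if_neg (by linarith), if_pos (by linarith), abs_of_neg h', zero_add]
      · rw [h', if_neg (lt_irrefl 0), neg_zero, if_neg (lt_irrefl 0), abs_zero, add_zero]
  have hsum : ∑ w ∈ fccSlots, |(A w) 2| = 2 * ∑ r ∈ fccSlots.filter (fun r => 0 < (A r) 2), (A r) 2 := by
    rw [Finset.sum_filter]
    simp_rw [hsplit]
    rw [sum_add_distrib]
    have hre : ∑ w ∈ fccSlots, (if 0 < (A (-w)) 2 then (A (-w)) 2 else 0) =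
        ∑ w ∈ fccSlots, (if 0 < (A w) 2 then (A w) 2 else 0) := by
      conv_rhs => rw [← image_neg_fccSlots]
      rw [sum_image (fun w _ w' _ h => neg_injective h)]
    rw [hre]; ring
  rw [hsum]; ring

section CensusFree

variable {δ : ℝ} (hg : KissingGap δ) (hc : KissingClassification δ)
include hg hc

open scoped Classical in
/-- **The census-free MULTI-ROOT rung for TRANSLATION pairs with a 3-adically generic offset**: charge `φ₁/78`,
orientation-free, modulo `KissingGap δ`, `KissingClassification δ` only.  See the module docstring. -/
theorem translate_twoSlabAdhesion_generic_multi
    (A₁ : EuclideanSpace ℝ (Fin 3) ≃ₗᵢ[ℝ] EuclideanSpace ℝ (Fin 3)) (t₁ : EuclideanSpace ℝ (Fin 3))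
    (A₂ : EuclideanSpace ℝ (Fin 3) ≃ₗᵢ[ℝ] EuclideanSpace ℝ (Fin 3)) (t₂ : EuclideanSpace ℝ (Fin 3))
    (htrans : A₁ '' fccStacking 1 (Real.sqrt (2 / 3)) = A₂ '' fccStacking 1 (Real.sqrt (2 / 3)))
    (hgen : ∀ k : ℕ, ((3 : ℝ) ^ k) • A₁.symm (t₂ - t₁) ∉ fccStacking 1 (Real.sqrt (2 / 3))) :
    ∃ C R₀ : ℝ, 1 ≤ R₀ ∧ ∀ h : ℝ, 0 ≤ h → ∀ ρ : ℝ, R₀ ≤ ρ →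
      ∀ X P₁ P₂ : Finset (EuclideanSpace ℝ (Fin 3)),
      (∀ p ∈ X, ∀ q ∈ X, p ≠ q → 1 ≤ dist p q) → P₁ ⊆ X → P₂ ⊆ X \ P₁ →
      (∀ p ∈ X, -(2 * R₀) ≤ p 2 ∧ p 2 ≤ h + 2 * R₀ ∧ p 0 ^ 2 + p 1 ^ 2 ≤ ρ ^ 2) →
      (∀ p, p ∈ P₁ ↔ (p ∈ (fun q => A₁ q + t₁) '' fccStacking 1 (Real.sqrt (2 / 3)) ∧
        -(2 * R₀) ≤ p 2 ∧ p 2 ≤ -R₀ ∧ p 0 ^ 2 + p 1 ^ 2 ≤ ρ ^ 2)) →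
      (∀ p, p ∈ P₂ ↔ (p ∈ (fun q => A₂ q + t₂) '' fccStacking 1 (Real.sqrt (2 / 3)) ∧
        h + R₀ ≤ p 2 ∧ p 2 ≤ h + 2 * R₀ ∧ p 0 ^ 2 + p 1 ^ 2 ≤ ρ ^ 2)) →
      ((((P₁ ×ˢ (X \ P₁)).filter fun pq => dist pq.1 pq.2 = 1).card : ℕ) : ℝ) +
        ((((P₂ ×ˢ ((X \ P₁) \ P₂)).filter fun pq => dist pq.1 pq.2 = 1).card : ℕ) : ℝ) ≤
        contactDeficiency ((X \ P₁) \ P₂) +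
          (Real.sqrt 2 / 4 * ∑ᶠ w ∈ {w ∈ fccStacking 1 (Real.sqrt (2 / 3)) | ‖w‖ = 1},
              |⟪w, A₁.symm (EuclideanSpace.single (2 : Fin 3) (1 : ℝ))⟫_ℝ| +
            Real.sqrt 2 / 4 * ∑ᶠ w ∈ {w ∈ fccStacking 1 (Real.sqrt (2 / 3)) | ‖w‖ = 1},
              |⟪w, A₂.symm (EuclideanSpace.single (2 : Fin 3) (1 : ℝ))⟫_ℝ| -
            (Real.sqrt 2 / 4 * ∑ᶠ w ∈ {w ∈ fccStacking 1 (Real.sqrt (2 / 3)) | ‖w‖ = 1},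
              |⟪w, A₁.symm (EuclideanSpace.single (2 : Fin 3) (1 : ℝ))⟫_ℝ|) / 78) * Real.pi * ρ ^ 2 +
          C * (1 + h) * ρ := by
  set φ₁ : ℝ := Real.sqrt 2 / 4 * ∑ᶠ w ∈ {w ∈ fccStacking 1 (Real.sqrt (2 / 3)) | ‖w‖ = 1},
      |⟪w, A₁.symm (EuclideanSpace.single (2 : Fin 3) (1 : ℝ))⟫_ℝ| with hφ₁
  -- the top grain in the bottom frame
  have hΛ₂ : (fun q => A₂ q + t₂) '' fccStacking 1 (Real.sqrt (2 / 3)) =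
      (fun q => A₁ q + t₂) '' fccStacking 1 (Real.sqrt (2 / 3)) := by
    have e2 : (fun q => A₂ q + t₂) '' fccStacking 1 (Real.sqrt (2 / 3)) =
        (fun y => y + t₂) '' (A₂ '' fccStacking 1 (Real.sqrt (2 / 3))) := by rw [Set.image_image]
    have e1 : (fun q => A₁ q + t₂) '' fccStacking 1 (Real.sqrt (2 / 3)) =
        (fun y => y + t₂) '' (A₁ '' fccStacking 1 (Real.sqrt (2 / 3))) := by rw [Set.image_image]
    rw [e2, e1, htrans]
  -- genericity in the cell's form
  have hgen' : ∀ k : ℕ, ∀ q ∈ fccStacking 1 (Real.sqrt (2 / 3)), ((3 : ℝ) ^ k) • (t₂ - t₁) ≠ A₁ q := by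
    intro k q hq heq
    apply hgen k
    have : ((3 : ℝ) ^ k) • A₁.symm (t₂ - t₁) = q := by
      apply A₁.injective
      rw [LinearIsometryEquiv.map_smul, A₁.apply_symm_apply, heq]
    rw [this]; exact hq
  -- the flux of all rising slots is `2 φ₁`
  have hflux : Real.sqrt 2 * ∑ r ∈ fccSlots.filter (fun r => 0 < (A₁ r) 2), (A₁ r) 2 = 2 * φ₁ :=
    sqrt_two_mul_sum_rising_eq_two_phi A₁
  set K : ℝ := 12 * (12 * Real.sqrt 2 * Real.pi + 36 * 10 + 55440) with hK
  have hK0 : 0 ≤ K := by positivity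
  obtain ⟨C, hC⟩ := twoSlab_cross_le_of_payers A₁ t₁ A₂ t₂ 10 le_rfl
  refine ⟨C + K / 78 / 2, 10, by norm_num, ?_⟩
  intro h hh ρ hρ X P₁ P₂ hX hP₁X hP₂X₁ hcyl hP₁ hP₂
  have hP₂X : P₂ ⊆ X := hP₂X₁.trans sdiff_subset
  have hρ0 : (0 : ℝ) ≤ ρ := by linarith
  have hP₂' : ∀ p, p ∈ P₂ ↔ (p ∈ (fun q => A₁ q + t₂) '' fccStacking 1 (Real.sqrt (2 / 3)) ∧
      h + 10 ≤ p 2 ∧ p 2 ≤ h + 2 * 10 ∧ p 0 ^ 2 + p 1 ^ 2 ≤ ρ ^ 2) := by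
    intro p; rw [hP₂, hΛ₂]
  have hcell := wordNet_trans_payers_ge_generic_multi hg hc A₁ t₁ t₂ X P₁ P₂ 10 h ρ le_rfl hh hρ
    hX hcyl hP₁X hP₂X hP₁ hP₂' hgen'
  rw [hflux, ← hK] at hcell
  have hpay : 2 * φ₁ / 78 * Real.pi * ρ ^ 2 - K / 78 * (1 + h) * ρ ≤
      ((X.filter fun z => (X.filter fun q => dist z q = 1).card ≤ 11 ∧
        -(10 : ℝ) - 2 ≤ z 2 ∧ z 2 ≤ h + 10 + 2).card : ℝ) := by
    have hKh : K * ρ ≤ K * (1 + h) * ρ := by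
      have := mul_nonneg (mul_nonneg hK0 hh) hρ0; linarith only [this]
    have e : 2 * φ₁ / 78 * Real.pi * ρ ^ 2 - K / 78 * (1 + h) * ρ =
        (2 * φ₁ * Real.pi * ρ ^ 2 - K * (1 + h) * ρ) / 78 := by ring
    rw [e, div_le_iff₀ (by norm_num : (0 : ℝ) < 78)]
    linarith only [hcell, hKh]
  have key := hC h hh ρ hρ X P₁ P₂ hX hP₁X hP₂X₁ hcyl hP₁ hP₂ (2 * φ₁ / 78) (K / 78) (by positivity) hpay
  have e : (2 * φ₁ / 78 : ℝ) / 2 = φ₁ / 78 := by ring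
  rw [e] at key
  exact key

end CensusFree

end Summit.Ventures.Crystal3D.Theorems

end
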